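import Mathlib
import Summits.ValiantsHypothesis.ValiantsHypothesis.Theorems.KPlusLogSqLawStepTripleCases

/-!
# The TRIPLE LAW — combined dispatcher and its dual for lower lines (static path model behind `KPlusLogSqLaw.TropicalB`)

Cell pub-symmetroid, seat conjb-2 (g22). A helper toward the crux `TropicalB`
(`Summit.ValiantsHypothesis.ValiantsHypothesis.Theses.KPlusLogSqLaw.TropicalB`, item
`stmt-ValiantsHypothesis-19771`); it earns no crux credit and is not evidence for `MatrixDescartes` or for
Valiant's hypothesis.

SETTING as in `KPlusLogSqLawStepTripleCases` (abstract upper class `up : ℕ → Prop`; window `[u, v]` separated at `θ`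
iff every `up` line of `[u, v]` is strictly above every non-`up` line at `θ`; rows step = consecutive separation sets
non-empty and disjoint; a row moves right / left = its two separation sets are ordered left-to-right / right-to-left).

CONTENT.
* `triple_mid_right`: the four landed cases `triple_rrr / rrl / lrr / lrl` of the TRIPLE LAW dispatched from the
  dichotomies of the outer rows: rows `i, i+1, i+2` step, row `i+1` moves RIGHT, rows `i` and `i+2` each move right or
  left ⟹ `s (i+2) < s (i+d+1)` (upper lines `i+2`, `i+d+1`; row-`i` exactness `hex` is derived from disjointness).
* `dual_sep` / `sep_of_dual`: the composite symmetry NEGATION ∘ REFLECTION — `up ↦ ¬ up`, `b ↦ -b`, `s ↦ s`, `θ ↦ -θ` —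
  maps separated windows to separated windows (pointwise, no index change), flips every direction and keeps slopes.
* `triple_mid_left_low`: the image of `triple_mid_right` under that symmetry: rows `i, i+1, i+2` step, row `i+1` moves
  LEFT, lines `i+2`, `i+d+1` are LOWER lines (`up (i+1)`, `¬ up (i+2)`, `¬ up (i+d+1)`, `up (i+d+2)`, `¬ up (i+d+3)`)
  ⟹ `s (i+2) < s (i+d+1)`.
USE (FOUR-STEP LAW, THEORY-NOTE-g22 §1quater (P1)): in the middle pattern `(R, L)` on rows `I, …, I+3` these give the two
monotonicities consumed by `KPlusLogSqLawStepFourOrder` — `triple_mid_right` at `i = I` gives `s (I+2) < s (I+d+1)`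
(`c` increasing) and `triple_mid_left_low` at `i = I+1` gives `s (I+3) < s (I+d+2)` (`c'` decreasing).
-/

set_option linter.dupNamespace false

namespace Summit.ValiantsHypothesis.ValiantsHypothesis.Theorems.KPlusLogSqLawStepTripleDual

open Summit.ValiantsHypothesis.ValiantsHypothesis.Theorems.KPlusLogSqLawStepTripleCases
  (triple_rrr triple_rrl triple_lrr triple_lrl)

/-- Exactness from disjointness: if `T[i, i+d]` and `T[i+1, i+d+1]` have no common point `θ`, the longer window
`[i, i+d+1]` is not separated at `θ`. -/
theorem not_sep_succ (up : ℕ → Prop) (s b : ℕ → ℝ) (i d : ℕ) (θ : ℝ)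
    (hdis : ¬ ((∀ e o : ℕ, i ≤ e → e ≤ i + d → i ≤ o → o ≤ i + d → up e → ¬ up o →
        b o + s o * θ < b e + s e * θ) ∧
      (∀ e o : ℕ, i + 1 ≤ e → e ≤ i + d + 1 → i + 1 ≤ o → o ≤ i + d + 1 → up e → ¬ up o →
        b o + s o * θ < b e + s e * θ))) :
    ¬ (∀ e o : ℕ, i ≤ e → e ≤ i + d + 1 → i ≤ o → o ≤ i + d + 1 → up e → ¬ up o →
        b o + s o * θ < b e + s e * θ) := by
  intro h
  exact hdis ⟨fun e o h1 h2 h3 h4 he ho => h e o h1 (by omega) h3 (by omega) he ho,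
    fun e o h1 h2 h3 h4 he ho => h e o (by omega) h2 (by omega) h4 he ho⟩

/-- TRIPLE LAW, middle row moving right, outer directions dispatched: rows `i, i+1, i+2` step, row `i+1` moves
right, rows `i` and `i+2` each move right or left ⟹ `s (i+2) < s (i+d+1)`. -/
theorem triple_mid_right (up : ℕ → Prop) (s b : ℕ → ℝ) (i d : ℕ) (hd : 2 ≤ d) (hlow1 : ¬ up (i + 1))
    (hup2 : up (i + 2)) (hup1 : up (i + d + 1)) (hlow2 : ¬ up (i + d + 2)) (hup3 : up (i + d + 3))
    (hA0 : ∃ θ : ℝ, (∀ e o : ℕ, i ≤ e → e ≤ i + d → i ≤ o → o ≤ i + d → up e → ¬ up o →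
        b o + s o * θ < b e + s e * θ))
    (hA1 : ∃ θ : ℝ, (∀ e o : ℕ, i + 1 ≤ e → e ≤ i + d + 1 → i + 1 ≤ o → o ≤ i + d + 1 → up e → ¬ up o →
        b o + s o * θ < b e + s e * θ))
    (hA2 : ∃ θ : ℝ, (∀ e o : ℕ, i + 2 ≤ e → e ≤ i + d + 2 → i + 2 ≤ o → o ≤ i + d + 2 → up e → ¬ up o →
        b o + s o * θ < b e + s e * θ))
    (hA3 : ∃ θ : ℝ, (∀ e o : ℕ, i + 3 ≤ e → e ≤ i + d + 3 → i + 3 ≤ o → o ≤ i + d + 3 → up e → ¬ up o →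
        b o + s o * θ < b e + s e * θ))
    (hA01 : ∀ θ : ℝ, ¬ ((∀ e o : ℕ, i ≤ e → e ≤ i + d → i ≤ o → o ≤ i + d → up e → ¬ up o →
        b o + s o * θ < b e + s e * θ) ∧
      (∀ e o : ℕ, i + 1 ≤ e → e ≤ i + d + 1 → i + 1 ≤ o → o ≤ i + d + 1 → up e → ¬ up o →
        b o + s o * θ < b e + s e * θ)))
    (hA12 : ∀ θ : ℝ, ¬ ((∀ e o : ℕ, i + 1 ≤ e → e ≤ i + d + 1 → i + 1 ≤ o → o ≤ i + d + 1 → up e → ¬ up o →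
        b o + s o * θ < b e + s e * θ) ∧
      (∀ e o : ℕ, i + 2 ≤ e → e ≤ i + d + 2 → i + 2 ≤ o → o ≤ i + d + 2 → up e → ¬ up o →
        b o + s o * θ < b e + s e * θ)))
    (hA23 : ∀ θ : ℝ, ¬ ((∀ e o : ℕ, i + 2 ≤ e → e ≤ i + d + 2 → i + 2 ≤ o → o ≤ i + d + 2 → up e → ¬ up o →
        b o + s o * θ < b e + s e * θ) ∧
      (∀ e o : ℕ, i + 3 ≤ e → e ≤ i + d + 3 → i + 3 ≤ o → o ≤ i + d + 3 → up e → ¬ up o →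
        b o + s o * θ < b e + s e * θ)))
    (hdir0 : (∀ θ θ' : ℝ, (∀ e o : ℕ, i ≤ e → e ≤ i + d → i ≤ o → o ≤ i + d → up e → ¬ up o →
        b o + s o * θ < b e + s e * θ) →
      (∀ e o : ℕ, i + 1 ≤ e → e ≤ i + d + 1 → i + 1 ≤ o → o ≤ i + d + 1 → up e → ¬ up o →
        b o + s o * θ' < b e + s e * θ') → θ < θ') ∨
      (∀ θ θ' : ℝ, (∀ e o : ℕ, i + 1 ≤ e → e ≤ i + d + 1 → i + 1 ≤ o → o ≤ i + d + 1 → up e → ¬ up o →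
        b o + s o * θ < b e + s e * θ) →
      (∀ e o : ℕ, i ≤ e → e ≤ i + d → i ≤ o → o ≤ i + d → up e → ¬ up o →
        b o + s o * θ' < b e + s e * θ') → θ < θ'))
    (hR1 : ∀ θ θ' : ℝ, (∀ e o : ℕ, i + 1 ≤ e → e ≤ i + d + 1 → i + 1 ≤ o → o ≤ i + d + 1 → up e → ¬ up o →
        b o + s o * θ < b e + s e * θ) →
      (∀ e o : ℕ, i + 2 ≤ e → e ≤ i + d + 2 → i + 2 ≤ o → o ≤ i + d + 2 → up e → ¬ up o →
        b o + s o * θ' < b e + s e * θ') → θ < θ')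
    (hdir2 : (∀ θ θ' : ℝ, (∀ e o : ℕ, i + 2 ≤ e → e ≤ i + d + 2 → i + 2 ≤ o → o ≤ i + d + 2 → up e → ¬ up o →
        b o + s o * θ < b e + s e * θ) →
      (∀ e o : ℕ, i + 3 ≤ e → e ≤ i + d + 3 → i + 3 ≤ o → o ≤ i + d + 3 → up e → ¬ up o →
        b o + s o * θ' < b e + s e * θ') → θ < θ') ∨
      (∀ θ θ' : ℝ, (∀ e o : ℕ, i + 2 ≤ e → e ≤ i + d + 2 → i + 2 ≤ o → o ≤ i + d + 2 → up e → ¬ up o →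
        b o + s o * θ < b e + s e * θ) →
      (∀ e o : ℕ, i + 3 ≤ e → e ≤ i + d + 3 → i + 3 ≤ o → o ≤ i + d + 3 → up e → ¬ up o →
        b o + s o * θ' < b e + s e * θ') → θ' < θ)) :
    s (i + 2) < s (i + d + 1) := by
  have hex : ∀ θ : ℝ, ¬ (∀ e o : ℕ, i ≤ e → e ≤ i + d + 1 → i ≤ o → o ≤ i + d + 1 → up e → ¬ up o →
        b o + s o * θ < b e + s e * θ) :=
    fun θ => not_sep_succ up s b i d θ (hA01 θ)
  rcases hdir0 with hR0 | hL0 <;> rcases hdir2 with hR2 | hL2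
  · exact triple_rrr up s b i d hd hup2 hup1 hlow2 hup3 hA0 hex hA1 hA2 hA3 hR0 hR1 hA23 hR2
  · exact triple_rrl up s b i d hd hup2 hup1 hlow2 hup3 hA0 hex hA1 hA2 hA3 hR0 hR1 hA23 hL2
  · exact triple_lrr up s b i d hd hlow1 hup2 hup1 hlow2 hup3 hA0 hA1 hA2 hA3 hL0 hA12 hR1 hA23 hR2
  · exact triple_lrl up s b i d hd hlow1 hup2 hup1 hlow2 hup3 hA0 hA1 hA2 hA3 hL0 hA12 hR1 hA23 hL2

/-- The composite symmetry (negate all lines and the upper class, reflect `θ`): a window separated at `θ` for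
`(up, s, b)` is separated at `-θ` for `(¬ up, s, -b)`. -/
theorem dual_sep (up : ℕ → Prop) (s b : ℕ → ℝ) (lo hi : ℕ) (θ : ℝ)
    (h : (∀ e o : ℕ, lo ≤ e → e ≤ hi → lo ≤ o → o ≤ hi → up e → ¬ up o →
        b o + s o * θ < b e + s e * θ)) :
    (∀ e o : ℕ, lo ≤ e → e ≤ hi → lo ≤ o → o ≤ hi → ¬ up e → ¬ ¬ up o →
        -b o + s o * -θ < -b e + s e * -θ) := by
  intro e o h1 h2 h3 h4 he ho
  have ho' : up o := Classical.not_not.mp ho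
  have := h o e h3 h4 h1 h2 ho' he
  linarith

/-- Converse transport: a window separated at `θ` for `(¬ up, s, -b)` is separated at `-θ` for `(up, s, b)`. -/
theorem sep_of_dual (up : ℕ → Prop) (s b : ℕ → ℝ) (lo hi : ℕ) (θ : ℝ)
    (h : (∀ e o : ℕ, lo ≤ e → e ≤ hi → lo ≤ o → o ≤ hi → ¬ up e → ¬ ¬ up o →
        -b o + s o * θ < -b e + s e * θ)) :
    (∀ e o : ℕ, lo ≤ e → e ≤ hi → lo ≤ o → o ≤ hi → up e → ¬ up o →
        b o + s o * -θ < b e + s e * -θ) := by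
  intro e o h1 h2 h3 h4 he ho
  have he' : ¬ ¬ up e := not_not_intro he
  have := h o e h3 h4 h1 h2 ho he'
  linarith

/-- TRIPLE LAW for LOWER lines, middle row moving left (the dual of `triple_mid_right`): rows `i, i+1, i+2` step,
row `i+1` moves left, rows `i`, `i+2` each move right or left, `up (i+1)`, `¬ up (i+2)`, `¬ up (i+d+1)`,
`up (i+d+2)`, `¬ up (i+d+3)` ⟹ `s (i+2) < s (i+d+1)`. -/
theorem triple_mid_left_low (up : ℕ → Prop) (s b : ℕ → ℝ) (i d : ℕ) (hd : 2 ≤ d) (hup1 : up (i + 1))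
    (hlow2 : ¬ up (i + 2)) (hlow1 : ¬ up (i + d + 1)) (hup2 : up (i + d + 2)) (hlow3 : ¬ up (i + d + 3))
    (hA0 : ∃ θ : ℝ, (∀ e o : ℕ, i ≤ e → e ≤ i + d → i ≤ o → o ≤ i + d → up e → ¬ up o →
        b o + s o * θ < b e + s e * θ))
    (hA1 : ∃ θ : ℝ, (∀ e o : ℕ, i + 1 ≤ e → e ≤ i + d + 1 → i + 1 ≤ o → o ≤ i + d + 1 → up e → ¬ up o →
        b o + s o * θ < b e + s e * θ))
    (hA2 : ∃ θ : ℝ, (∀ e o : ℕ, i + 2 ≤ e → e ≤ i + d + 2 → i + 2 ≤ o → o ≤ i + d + 2 → up e → ¬ up o →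
        b o + s o * θ < b e + s e * θ))
    (hA3 : ∃ θ : ℝ, (∀ e o : ℕ, i + 3 ≤ e → e ≤ i + d + 3 → i + 3 ≤ o → o ≤ i + d + 3 → up e → ¬ up o →
        b o + s o * θ < b e + s e * θ))
    (hA01 : ∀ θ : ℝ, ¬ ((∀ e o : ℕ, i ≤ e → e ≤ i + d → i ≤ o → o ≤ i + d → up e → ¬ up o →
        b o + s o * θ < b e + s e * θ) ∧
      (∀ e o : ℕ, i + 1 ≤ e → e ≤ i + d + 1 → i + 1 ≤ o → o ≤ i + d + 1 → up e → ¬ up o →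
        b o + s o * θ < b e + s e * θ)))
    (hA12 : ∀ θ : ℝ, ¬ ((∀ e o : ℕ, i + 1 ≤ e → e ≤ i + d + 1 → i + 1 ≤ o → o ≤ i + d + 1 → up e → ¬ up o →
        b o + s o * θ < b e + s e * θ) ∧
      (∀ e o : ℕ, i + 2 ≤ e → e ≤ i + d + 2 → i + 2 ≤ o → o ≤ i + d + 2 → up e → ¬ up o →
        b o + s o * θ < b e + s e * θ)))
    (hA23 : ∀ θ : ℝ, ¬ ((∀ e o : ℕ, i + 2 ≤ e → e ≤ i + d + 2 → i + 2 ≤ o → o ≤ i + d + 2 → up e → ¬ up o →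
        b o + s o * θ < b e + s e * θ) ∧
      (∀ e o : ℕ, i + 3 ≤ e → e ≤ i + d + 3 → i + 3 ≤ o → o ≤ i + d + 3 → up e → ¬ up o →
        b o + s o * θ < b e + s e * θ)))
    (hdir0 : (∀ θ θ' : ℝ, (∀ e o : ℕ, i ≤ e → e ≤ i + d → i ≤ o → o ≤ i + d → up e → ¬ up o →
        b o + s o * θ < b e + s e * θ) →
      (∀ e o : ℕ, i + 1 ≤ e → e ≤ i + d + 1 → i + 1 ≤ o → o ≤ i + d + 1 → up e → ¬ up o →
        b o + s o * θ' < b e + s e * θ') → θ < θ') ∨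
      (∀ θ θ' : ℝ, (∀ e o : ℕ, i + 1 ≤ e → e ≤ i + d + 1 → i + 1 ≤ o → o ≤ i + d + 1 → up e → ¬ up o →
        b o + s o * θ < b e + s e * θ) →
      (∀ e o : ℕ, i ≤ e → e ≤ i + d → i ≤ o → o ≤ i + d → up e → ¬ up o →
        b o + s o * θ' < b e + s e * θ') → θ < θ'))
    (hL1 : ∀ θ θ' : ℝ, (∀ e o : ℕ, i + 1 ≤ e → e ≤ i + d + 1 → i + 1 ≤ o → o ≤ i + d + 1 → up e → ¬ up o →
        b o + s o * θ < b e + s e * θ) →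
      (∀ e o : ℕ, i + 2 ≤ e → e ≤ i + d + 2 → i + 2 ≤ o → o ≤ i + d + 2 → up e → ¬ up o →
        b o + s o * θ' < b e + s e * θ') → θ' < θ)
    (hdir2 : (∀ θ θ' : ℝ, (∀ e o : ℕ, i + 2 ≤ e → e ≤ i + d + 2 → i + 2 ≤ o → o ≤ i + d + 2 → up e → ¬ up o →
        b o + s o * θ < b e + s e * θ) →
      (∀ e o : ℕ, i + 3 ≤ e → e ≤ i + d + 3 → i + 3 ≤ o → o ≤ i + d + 3 → up e → ¬ up o →
        b o + s o * θ' < b e + s e * θ') → θ < θ') ∨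
      (∀ θ θ' : ℝ, (∀ e o : ℕ, i + 2 ≤ e → e ≤ i + d + 2 → i + 2 ≤ o → o ≤ i + d + 2 → up e → ¬ up o →
        b o + s o * θ < b e + s e * θ) →
      (∀ e o : ℕ, i + 3 ≤ e → e ≤ i + d + 3 → i + 3 ≤ o → o ≤ i + d + 3 → up e → ¬ up o →
        b o + s o * θ' < b e + s e * θ') → θ' < θ)) :
    s (i + 2) < s (i + d + 1) := by
  -- transport every hypothesis to the dual configuration `(¬ up, s, -b)` at `-θ`
  have k1 : ¬ ¬ up (i + 1) := not_not_intro hup1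
  have k2 : ¬ ¬ up (i + d + 2) := not_not_intro hup2
  have dA0 : ∃ θ : ℝ, (∀ e o : ℕ, i ≤ e → e ≤ i + d → i ≤ o → o ≤ i + d → ¬ up e → ¬ ¬ up o →
        -b o + s o * θ < -b e + s e * θ) := by
    obtain ⟨θ, h⟩ := hA0
    exact ⟨-θ, dual_sep up s b i (i + d) θ h⟩
  have dA1 : ∃ θ : ℝ, (∀ e o : ℕ, i + 1 ≤ e → e ≤ i + d + 1 → i + 1 ≤ o → o ≤ i + d + 1 → ¬ up e → ¬ ¬ up o →
        -b o + s o * θ < -b e + s e * θ) := by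
    obtain ⟨θ, h⟩ := hA1
    exact ⟨-θ, dual_sep up s b (i + 1) (i + d + 1) θ h⟩
  have dA2 : ∃ θ : ℝ, (∀ e o : ℕ, i + 2 ≤ e → e ≤ i + d + 2 → i + 2 ≤ o → o ≤ i + d + 2 → ¬ up e → ¬ ¬ up o →
        -b o + s o * θ < -b e + s e * θ) := by
    obtain ⟨θ, h⟩ := hA2
    exact ⟨-θ, dual_sep up s b (i + 2) (i + d + 2) θ h⟩
  have dA3 : ∃ θ : ℝ, (∀ e o : ℕ, i + 3 ≤ e → e ≤ i + d + 3 → i + 3 ≤ o → o ≤ i + d + 3 → ¬ up e → ¬ ¬ up o →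
        -b o + s o * θ < -b e + s e * θ) := by
    obtain ⟨θ, h⟩ := hA3
    exact ⟨-θ, dual_sep up s b (i + 3) (i + d + 3) θ h⟩
  have dA01 : ∀ θ : ℝ, ¬ ((∀ e o : ℕ, i ≤ e → e ≤ i + d → i ≤ o → o ≤ i + d → ¬ up e → ¬ ¬ up o →
        -b o + s o * θ < -b e + s e * θ) ∧
      (∀ e o : ℕ, i + 1 ≤ e → e ≤ i + d + 1 → i + 1 ≤ o → o ≤ i + d + 1 → ¬ up e → ¬ ¬ up o →
        -b o + s o * θ < -b e + s e * θ)) := by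
    intro θ h
    exact hA01 (-θ) ⟨sep_of_dual up s b i (i + d) θ h.1,
      sep_of_dual up s b (i + 1) (i + d + 1) θ h.2⟩
  have dA12 : ∀ θ : ℝ, ¬ ((∀ e o : ℕ, i + 1 ≤ e → e ≤ i + d + 1 → i + 1 ≤ o → o ≤ i + d + 1 → ¬ up e → ¬ ¬ up o →
        -b o + s o * θ < -b e + s e * θ) ∧
      (∀ e o : ℕ, i + 2 ≤ e → e ≤ i + d + 2 → i + 2 ≤ o → o ≤ i + d + 2 → ¬ up e → ¬ ¬ up o →
        -b o + s o * θ < -b e + s e * θ)) := by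
    intro θ h
    exact hA12 (-θ) ⟨sep_of_dual up s b (i + 1) (i + d + 1) θ h.1,
      sep_of_dual up s b (i + 2) (i + d + 2) θ h.2⟩
  have dA23 : ∀ θ : ℝ, ¬ ((∀ e o : ℕ, i + 2 ≤ e → e ≤ i + d + 2 → i + 2 ≤ o → o ≤ i + d + 2 → ¬ up e → ¬ ¬ up o →
        -b o + s o * θ < -b e + s e * θ) ∧
      (∀ e o : ℕ, i + 3 ≤ e → e ≤ i + d + 3 → i + 3 ≤ o → o ≤ i + d + 3 → ¬ up e → ¬ ¬ up o →
        -b o + s o * θ < -b e + s e * θ)) := by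
    intro θ h
    exact hA23 (-θ) ⟨sep_of_dual up s b (i + 2) (i + d + 2) θ h.1,
      sep_of_dual up s b (i + 3) (i + d + 3) θ h.2⟩
  have ddir0 : (∀ θ θ' : ℝ, (∀ e o : ℕ, i ≤ e → e ≤ i + d → i ≤ o → o ≤ i + d → ¬ up e → ¬ ¬ up o →
        -b o + s o * θ < -b e + s e * θ) →
      (∀ e o : ℕ, i + 1 ≤ e → e ≤ i + d + 1 → i + 1 ≤ o → o ≤ i + d + 1 → ¬ up e → ¬ ¬ up o →
        -b o + s o * θ' < -b e + s e * θ') → θ < θ') ∨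
      (∀ θ θ' : ℝ, (∀ e o : ℕ, i + 1 ≤ e → e ≤ i + d + 1 → i + 1 ≤ o → o ≤ i + d + 1 → ¬ up e → ¬ ¬ up o →
        -b o + s o * θ < -b e + s e * θ) →
      (∀ e o : ℕ, i ≤ e → e ≤ i + d → i ≤ o → o ≤ i + d → ¬ up e → ¬ ¬ up o →
        -b o + s o * θ' < -b e + s e * θ') → θ < θ') := by
    rcases hdir0 with hR | hL
    · right
      intro θ θ' h h'
      have := hR (-θ') (-θ) (sep_of_dual up s b i (i + d) θ' h') (sep_of_dual up s b (i + 1) (i + d + 1) θ h)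
      linarith
    · left
      intro θ θ' h h'
      have := hL (-θ') (-θ) (sep_of_dual up s b (i + 1) (i + d + 1) θ' h') (sep_of_dual up s b i (i + d) θ h)
      linarith
  have dR1 : ∀ θ θ' : ℝ, (∀ e o : ℕ, i + 1 ≤ e → e ≤ i + d + 1 → i + 1 ≤ o → o ≤ i + d + 1 → ¬ up e → ¬ ¬ up o →
        -b o + s o * θ < -b e + s e * θ) →
      (∀ e o : ℕ, i + 2 ≤ e → e ≤ i + d + 2 → i + 2 ≤ o → o ≤ i + d + 2 → ¬ up e → ¬ ¬ up o →
        -b o + s o * θ' < -b e + s e * θ') → θ < θ' := by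
    intro θ θ' h h'
    have := hL1 (-θ) (-θ') (sep_of_dual up s b (i + 1) (i + d + 1) θ h) (sep_of_dual up s b (i + 2) (i + d + 2) θ' h')
    linarith
  have ddir2 : (∀ θ θ' : ℝ, (∀ e o : ℕ, i + 2 ≤ e → e ≤ i + d + 2 → i + 2 ≤ o → o ≤ i + d + 2 → ¬ up e → ¬ ¬ up o →
        -b o + s o * θ < -b e + s e * θ) →
      (∀ e o : ℕ, i + 3 ≤ e → e ≤ i + d + 3 → i + 3 ≤ o → o ≤ i + d + 3 → ¬ up e → ¬ ¬ up o →
        -b o + s o * θ' < -b e + s e * θ') → θ < θ') ∨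
      (∀ θ θ' : ℝ, (∀ e o : ℕ, i + 2 ≤ e → e ≤ i + d + 2 → i + 2 ≤ o → o ≤ i + d + 2 → ¬ up e → ¬ ¬ up o →
        -b o + s o * θ < -b e + s e * θ) →
      (∀ e o : ℕ, i + 3 ≤ e → e ≤ i + d + 3 → i + 3 ≤ o → o ≤ i + d + 3 → ¬ up e → ¬ ¬ up o →
        -b o + s o * θ' < -b e + s e * θ') → θ' < θ) := by
    rcases hdir2 with hR | hL
    · right
      intro θ θ' h h'
      have := hR (-θ) (-θ') (sep_of_dual up s b (i + 2) (i + d + 2) θ h) (sep_of_dual up s b (i + 3) (i + d + 3) θ' h')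
      linarith
    · left
      intro θ θ' h h'
      have := hL (-θ) (-θ') (sep_of_dual up s b (i + 2) (i + d + 2) θ h) (sep_of_dual up s b (i + 3) (i + d + 3) θ' h')
      linarith
  exact triple_mid_right (fun t => ¬ up t) s (fun t => -b t) i d hd k1 hlow2 hlow1 k2 hlow3 dA0 dA1 dA2 dA3
    dA01 dA12 dA23 ddir0 dR1 ddir2

end Summit.ValiantsHypothesis.ValiantsHypothesis.Theorems.KPlusLogSqLawStepTripleDual
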